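import Summits.HodgeConjecture.CorCM.Census.DecicWeil23Pair
import Summits.HodgeConjecture.CorCM.OcticCurveFourfoldFrameTransfer
import Mathlib.GroupTheory.GroupAction.MultipleTransitivity
import HarnessLib

/-!
# COR-CM — two `(2,3)`-types over one decic CM field: the sixty tabulated EVEN permutations of the five conjugate pairs are
# realised by automorphisms of `ℂ` as soon as `Aut(ℂ/k)` is `3`-TRANSITIVE on the five embeddings over `τ`

Cell `pub-hodgecm2` (COR-CM), seat b30 gen 22 (2026-08-22); count-neutral own lane DECIC-WEIL-23PAIR.  Theorems only; no
definition, no named fact, no `sorry`.  This file discharges the Galois input `hgal` of the frame form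
(`CorCM/DecicWeil23PairFrameTransfer.lean`: each `permD r` is induced by some `ρ ∈ Aut(ℂ)` with `ρ ∘ e⁻¹(a,true) = e⁻¹(permD r a, true)`)
from the `3`-TRANSITIVITY hypothesis `h3t` (every ordered triple of distinct pairs is moved to `(0, 1, 2)` by some automorphism of
`ℂ`), the degree-`10` analogue of `CorCM/OcticWeilOrbitRealisers.lean` (`2`-transitivity on four pairs).  On five letters a
`2`-transitive group need not contain `A₅` (the Frobenius group `F₂₀` is sharply `2`-transitive), but a `3`-transitive one does:
the Galois group of the totally real quintic `K⁺` is then `A₅` or `S₅` — the generic case.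

* §1 `exists_perm_of_comp_tau_eq₅` — an automorphism of `ℂ` fixing `τ` permutes the five embeddings over `τ`;
* §2 **`alternatingGroup_le_realised₅`** — the realised permutations `{π | ∃ ρ, ∀ a, ρ ∘ e⁻¹(a,true) = e⁻¹(π a, true)}` form a
  SUBGROUP of `Sym(Fin 5)` (composition / inverse of automorphisms); under `h3t` it is `3`-pretransitive, hence contains `Alt(Fin 5)`
  (Mathlib `IsMultiplyPretransitive.alternatingGroup_le`: a `(|α| − 2)`-pretransitive subgroup of `Sym(α)` contains `Alt(α)`);
* §3 **`hgal_of_h3t`** — each tabulated even permutation `permD r` (`Census/DecicWeil23Pair`) is realised.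
HONEST FRAMING: nothing about the Hodge conjecture is concluded here; `HC_CM` is not asserted.
[cite: Shimura1998, §18.2 Lemma (i)] [cite: DixonMortimer1996, Thm 7.6A]

## References
* [Shimura1998] G. Shimura, *Abelian varieties with complex multiplication and modular functions*, §18.2 Lemma (i).
  [DixonMortimer1996] J. D. Dixon, B. Mortimer, *Permutation Groups*, GTM 163 (1996), Thm 7.6A (highly transitive groups
  contain the alternating group: the case `k = n − 2`).
-/

noncomputable section

open NumberField

namespace Summit.HodgeConjecture.CorCM.DecicWeil23Pair

open Summit.HodgeConjecture.CorCM.Census.DecicWeil23Pair (permD)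
open Summit.HodgeConjecture.CorCM.OcticCurveFourfold (comp_injective)

open scoped Classical

/-! ## §1 Automorphisms fixing `τ` permute the conjugate pairs -/

section Realisers

variable {F k : Type} [Field F] [Field k] {e : (F →+* ℂ) ≃ Fin 5 × Bool} {τ : k →+* ℂ} {i : k →+* F}
  (he_sign : ∀ s : F →+* ℂ, (e s).2 = true ↔ s.comp i = τ)

include he_sign in
/-- **An automorphism of `ℂ` fixing `τ` permutes the five embeddings over `τ`**: `ρ ∘ e⁻¹(a, true) = e⁻¹(π a, true)` for a
permutation `π` of `Fin 5` (injective self-map of a finite set). [cite: Shimura1998, §18.2 Lemma (i)] -/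
theorem exists_perm_of_comp_tau_eq₅ (ρ : ℂ ≃+* ℂ) (hρ : (ρ : ℂ →+* ℂ).comp τ = τ) :
    ∃ π : Equiv.Perm (Fin 5), ∀ a : Fin 5, (ρ : ℂ →+* ℂ).comp (e.symm (a, true)) = e.symm (π a, true) := by
  -- the image of `e⁻¹(a, true)` lies over `τ`, so it is `e⁻¹(f a, true)`
  have hover : ∀ a : Fin 5, (e ((ρ : ℂ →+* ℂ).comp (e.symm (a, true)))).2 = true := fun a => by
    rw [he_sign, RingHom.comp_assoc, (he_sign _).1 (by rw [Equiv.apply_symm_apply]), hρ]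
  let f : Fin 5 → Fin 5 := fun a => (e ((ρ : ℂ →+* ℂ).comp (e.symm (a, true)))).1
  have hf : ∀ a : Fin 5, (ρ : ℂ →+* ℂ).comp (e.symm (a, true)) = e.symm (f a, true) := fun a => by
    apply e.injective
    rw [Equiv.apply_symm_apply]
    exact Prod.ext rfl (hover a)
  have hfinj : Function.Injective f := fun a b hab => by
    have h : (ρ : ℂ →+* ℂ).comp (e.symm (a, true)) = (ρ : ℂ →+* ℂ).comp (e.symm (b, true)) := by
      rw [hf a, hf b, hab]
    have h' := e.symm.injective (comp_injective (K := F) ρ h)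
    exact (Prod.mk.inj h').1
  exact ⟨Equiv.ofBijective f (Finite.injective_iff_bijective.1 hfinj), fun a => hf a⟩

/-! ## §2 The realised permutations form a `3`-transitive subgroup of `S₅`, hence contain `A₅` -/

include he_sign in
/-- **The realised permutations contain the alternating group.**  If every ordered triple of distinct conjugate pairs is moved
to `(0, 1, 2)` by some automorphism of `ℂ` (`h3t`), then EVERY even permutation `π` of the five pairs is realised:
`∃ ρ, ∀ a, ρ ∘ e⁻¹(a, true) = e⁻¹(π a, true)` (realised permutations form a `3`-pretransitive subgroup of `S₅`; such a subgroup
contains `A₅`). [cite: DixonMortimer1996, Thm 7.6A] -/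
theorem alternatingGroup_le_realised₅
    (h3t : ∀ a b c : Fin 5, a ≠ b → a ≠ c → b ≠ c → ∃ ρ : ℂ ≃+* ℂ,
      (ρ : ℂ →+* ℂ).comp (e.symm (a, true)) = e.symm (0, true) ∧ (ρ : ℂ →+* ℂ).comp (e.symm (b, true)) = e.symm (1, true) ∧
        (ρ : ℂ →+* ℂ).comp (e.symm (c, true)) = e.symm (2, true))
    {π : Equiv.Perm (Fin 5)} (hπ : π ∈ alternatingGroup (Fin 5)) :
    ∃ ρ : ℂ ≃+* ℂ, ∀ a : Fin 5, (ρ : ℂ →+* ℂ).comp (e.symm (a, true)) = e.symm (π a, true) := by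
  -- the subgroup of realised permutations
  let H : Subgroup (Equiv.Perm (Fin 5)) :=
    { carrier := {π | ∃ ρ : ℂ ≃+* ℂ, ∀ a : Fin 5, (ρ : ℂ →+* ℂ).comp (e.symm (a, true)) = e.symm (π a, true)}
      mul_mem' := by
        rintro π₁ π₂ ⟨ρ₁, h₁⟩ ⟨ρ₂, h₂⟩
        refine ⟨ρ₂.trans ρ₁, fun a => ?_⟩
        rw [RingEquiv.coe_ringHom_trans, RingHom.comp_assoc, h₂ a, h₁ (π₂ a), Equiv.Perm.mul_apply]
      one_mem' := ⟨RingEquiv.refl ℂ, fun a => by rw [RingEquiv.coe_ringHom_refl, RingHom.id_comp, Equiv.Perm.one_apply]⟩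
      inv_mem' := by
        rintro π ⟨ρ, h⟩
        refine ⟨ρ.symm, fun a => ?_⟩
        have key := h (π⁻¹ a)
        rw [show π (π⁻¹ a) = a from (Equiv.apply_eq_iff_eq_symm_apply π).mpr rfl] at key
        rw [← key, ← RingHom.comp_assoc]
        have : ((ρ.symm : ℂ ≃+* ℂ) : ℂ →+* ℂ).comp (ρ : ℂ →+* ℂ) = RingHom.id ℂ :=
          RingHom.ext fun z => ρ.symm_apply_apply z
        rw [this, RingHom.id_comp] }
  -- every realiser of `(a, b, c) ↦ (0, 1, 2)` yields an element of `H`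
  have hmem : ∀ a b c : Fin 5, a ≠ b → a ≠ c → b ≠ c → ∃ g : ↥H, (g : Equiv.Perm (Fin 5)) a = 0 ∧
      (g : Equiv.Perm (Fin 5)) b = 1 ∧ (g : Equiv.Perm (Fin 5)) c = 2 := by
    intro a b c hab hac hbc
    obtain ⟨ρ, hρa, hρb, hρc⟩ := h3t a b c hab hac hbc
    have hρτ : (ρ : ℂ →+* ℂ).comp τ = τ := by
      have ha : (e.symm (a, true)).comp i = τ := (he_sign _).1 (by rw [Equiv.apply_symm_apply])
      have h0 : (e.symm ((0 : Fin 5), true)).comp i = τ := (he_sign _).1 (by rw [Equiv.apply_symm_apply])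
      calc (ρ : ℂ →+* ℂ).comp τ = ((ρ : ℂ →+* ℂ).comp (e.symm (a, true))).comp i := by rw [RingHom.comp_assoc, ha]
        _ = τ := by rw [hρa, h0]
    obtain ⟨π₀, hπ₀⟩ := exists_perm_of_comp_tau_eq₅ he_sign ρ hρτ
    refine ⟨⟨π₀, ρ, hπ₀⟩, ?_, ?_, ?_⟩
    · have h := (hπ₀ a).symm.trans hρa
      exact (Prod.mk.inj (e.symm.injective h)).1
    · have h := (hπ₀ b).symm.trans hρb
      exact (Prod.mk.inj (e.symm.injective h)).1
    · have h := (hπ₀ c).symm.trans hρc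
      exact (Prod.mk.inj (e.symm.injective h)).1
  -- `H` is `3`-pretransitive on `Fin 5`
  have h3 : MulAction.IsMultiplyPretransitive (↥H) (Fin 5) 3 := by
    rw [MulAction.isMultiplyPretransitive_iff]
    intro x y
    obtain ⟨g₁, hg₁a, hg₁b, hg₁c⟩ := hmem (x 0) (x 1) (x 2) (fun h => by simpa using x.injective h)
      (fun h => by simpa using x.injective h) (fun h => by simpa using x.injective h)
    obtain ⟨g₂, hg₂a, hg₂b, hg₂c⟩ := hmem (y 0) (y 1) (y 2) (fun h => by simpa using y.injective h)
      (fun h => by simpa using y.injective h) (fun h => by simpa using y.injective h)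
    refine ⟨g₂⁻¹ * g₁, ?_⟩
    ext j
    rw [Function.Embedding.smul_apply]
    change (((g₂⁻¹ * g₁ : ↥H) : Equiv.Perm (Fin 5)) (x j) : ℕ) = (y j : ℕ)
    congr 1
    rw [Subgroup.coe_mul, Subgroup.coe_inv, Equiv.Perm.mul_apply]
    fin_cases j
    · change ((g₂ : Equiv.Perm (Fin 5)))⁻¹ ((g₁ : Equiv.Perm (Fin 5)) (x 0)) = y 0
      rw [hg₁a]; exact Equiv.Perm.inv_eq_iff_eq.2 hg₂a.symm
    · change ((g₂ : Equiv.Perm (Fin 5)))⁻¹ ((g₁ : Equiv.Perm (Fin 5)) (x 1)) = y 1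
      rw [hg₁b]; exact Equiv.Perm.inv_eq_iff_eq.2 hg₂b.symm
    · change ((g₂ : Equiv.Perm (Fin 5)))⁻¹ ((g₁ : Equiv.Perm (Fin 5)) (x 2)) = y 2
      rw [hg₁c]; exact Equiv.Perm.inv_eq_iff_eq.2 hg₂c.symm
  have hcard : Nat.card (Fin 5) - 2 = 3 := by rw [Nat.card_eq_fintype_card, Fintype.card_fin]
  have hle : alternatingGroup (Fin 5) ≤ H :=
    IsMultiplyPretransitive.alternatingGroup_le (Fin 5) H (by rw [hcard]; exact h3)
  exact hle hπ

/-! ## §3 The sixty tabulated even permutations are realised -/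

/-- The table `permD` of `Census/DecicWeil23Pair` lists EVEN permutations (each is a permutation of `Fin 5` of sign `1`).
[folklore] -/
theorem exists_even_perm_eq_permD : ∀ r : Fin 60, ∃ π : Equiv.Perm (Fin 5),
    Equiv.Perm.sign π = 1 ∧ ∀ a : Fin 5, π a = permD r a := by
  unfold permD
  decide +kernel

include he_sign in
/-- **`hgal` from `h3t`**: under `3`-transitivity of `Aut(ℂ/k)` on the embeddings over `τ` (frame form), each of the sixty even
permutations `permD r` of the conjugate pairs is induced by an automorphism of `ℂ`. [cite: DixonMortimer1996, Thm 7.6A] -/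
theorem hgal_of_h3t
    (h3t : ∀ a b c : Fin 5, a ≠ b → a ≠ c → b ≠ c → ∃ ρ : ℂ ≃+* ℂ,
      (ρ : ℂ →+* ℂ).comp (e.symm (a, true)) = e.symm (0, true) ∧ (ρ : ℂ →+* ℂ).comp (e.symm (b, true)) = e.symm (1, true) ∧
        (ρ : ℂ →+* ℂ).comp (e.symm (c, true)) = e.symm (2, true))
    (r : Fin 60) :
    ∃ ρ : ℂ ≃+* ℂ, ∀ a : Fin 5, (ρ : ℂ →+* ℂ).comp (e.symm (a, true)) = e.symm (permD r a, true) := by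
  obtain ⟨π, hsign, hπ⟩ := exists_even_perm_eq_permD r
  obtain ⟨ρ, hρ⟩ := alternatingGroup_le_realised₅ he_sign h3t (Equiv.Perm.mem_alternatingGroup.2 hsign)
  exact ⟨ρ, fun a => by rw [hρ a, hπ a]⟩

end Realisers

end Summit.HodgeConjecture.CorCM.DecicWeil23Pair

end
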